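import Literature.Analysis.FluidPDE.CheskidovShvydkoyBlockTime
import Literature.Analysis.FluidPDE.CheskidovShvydkoyDyadicEnergy
import Literature.Analysis.FluidPDE.DissipationWavenumber
import Literature.Analysis.FunctionSpaces.SobolevDomainProofs
import Mathlib.Topology.Semicontinuity.Basic
import HarnessLib

/-!
# Measurability in time of the block sup norms and of the occupation integrand along a continuous slab

Analysis/FluidPDE support file (serves the discharge of the named fact
`Literature.Analysis.FluidPDE.cheskidov_dai_occupation_regular` — Cheskidov–Dai, arXiv:1507.06611 =
Proc. Edinburgh Math. Soc. (2025), Thm. 1.1). The hypothesis of Thm. 1.1 is a bound on the time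
integrals `∫_{T/2}^T 1_{q ≤ Q(τ)} λ_q ‖u_q(τ)‖_∞ dτ`, level by level; the proof sums finitely many levels
under the integral ("`∫ f_{>q*} = ∑_{q* < q ≤ Q̄} ∫ 1_{q ≤ Q(τ)} λ_q ‖u_q‖_∞`", §3.1), which with LOWER
Lebesgue integrals requires the measurability of the integrands. This file proves it along slabs on
which the field is jointly continuous and bounded (the smooth pieces of the tree's Leray–Hopf solutions):

* `eLpNorm_top_eq_iSup_enorm_of_continuous` — for a continuous field the `L^∞` norm is the supremum;
* `exists_measurable_eq_blockSup` — `t ↦ ‖Δ̇_j w(t)‖_{L^∞}` agrees on the slab `[a, b]` with a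
  measurable function (the supremum over `x` of the continuous `t ↦ ‖Δ̇_j w(t̂)(x)‖`, `t̂` the projection
  onto `[a, b]`, is lower semicontinuous);
* `aemeasurable_occupation_restrict` — the occupation integrand
  `τ ↦ 1_{2^q ≤ Λ_{c,ν}(w τ)} 2^q ‖Δ̇_q w(τ)‖_∞` is a.e.-measurable for `volume.restrict (Icc a b)`
  (`{2^q ≤ Λ} = {q = 0} ∪ ⋃_{j ≥ q} {c ν 2^j ≤ ‖Δ̇_j w‖_∞}`, tree `two_pow_le_dissipationWavenumber_iff`).

Used by `CheskidovDaiPiece.piece_lowMode` (the occupation integrands along the smooth pieces).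

(Re-filed 2026-08-24 to re-trigger the module build.)

## References

* A. Cheskidov, M. Dai, arXiv:1507.06611 = Proc. Edinburgh Math. Soc. (2025), §3.1 (the sum over
  levels under the time integral). [CheskidovDai2015]
-/

noncomputable section

open MeasureTheory Filter Topology Function Set
open Literature.Analysis.FunctionSpaces
open scoped ENNReal NNReal

namespace Literature.Analysis.FluidPDE

section Measurable

variable {E : Type*} [NormedAddCommGroup E] [InnerProductSpace ℝ E] [FiniteDimensional ℝ E]
  [MeasurableSpace E] [BorelSpace E]
variable {E' : Type*} [NormedAddCommGroup E'] [NormedSpace ℝ E']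

omit [NormedSpace ℝ E'] in
/-- For a continuous function on a finite-dimensional space the `L^∞` norm is the supremum of the
pointwise norms (Lebesgue measure charges every nonempty open set). [folklore] -/
private theorem eLpNorm_top_eq_iSup_enorm_of_continuous {g : E → E'} (hg : Continuous g) :
    eLpNorm g ∞ (volume : Measure E) = ⨆ x, ‖g x‖ₑ := by
  refine le_antisymm ?_ (iSup_le fun x => FunctionSpaces.enorm_le_eLpNorm_top_of_continuous volume hg x)
  rw [eLpNorm_exponent_top]
  exact essSup_le_iSup

/-- **The block sup norms along a jointly continuous bounded slab agree on the slab with a measurable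
function of time** (lower semicontinuity of `t ↦ sup_x ‖Δ̇_j w(t̂)(x)‖`, `t̂ = proj_{[a,b]} t`).
[cite: CheskidovDai2015, §3.1 (the sum over levels under the time integral)] -/
theorem exists_measurable_eq_blockSup {ι : Type*} [Fintype ι] {a b : ℝ} (hab : a ≤ b)
    {w : ℝ → EuclideanSpace ℝ ι → EuclideanSpace ℝ ι}
    (hc : ContinuousOn (uncurry w) (Icc a b ×ˢ univ)) {M : ℝ} (hM : ∀ t ∈ Icc a b, ∀ x, ‖w t x‖ ≤ M) (j : ℤ) :
    ∃ S : ℝ → ℝ≥0∞, Measurable S ∧ ∀ t ∈ Icc a b, S t = blockSup (w t) j := by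
  -- clamp the time variable to the slab
  set we : ℝ → EuclideanSpace ℝ ι → EuclideanSpace ℝ ι := fun t => w (projIcc a b hab t) with hwe
  have hproj : ∀ t, (projIcc a b hab t : ℝ) ∈ Icc a b := fun t => (projIcc a b hab t).2
  have hce : ContinuousOn (uncurry we) (univ ×ˢ univ) := by
    have h1 : Continuous fun z : ℝ × EuclideanSpace ℝ ι => ((projIcc a b hab z.1 : ℝ), z.2) :=
      (continuous_subtype_val.comp (continuous_projIcc.comp continuous_fst)).prodMk continuous_snd
    have h2 := hc.comp_continuous h1 fun z => ⟨hproj z.1, mem_univ _⟩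
    exact h2.continuousOn
  have hMe : ∀ t ∈ (univ : Set ℝ), ∀ x, ‖we t x‖ ≤ M := fun t _ x => hM _ (hproj t) x
  -- continuity in time of the clamped blocks at every point
  have hct : ∀ x, Continuous fun t => blockFn j (we t) x := fun x =>
    continuousOn_univ.1 (continuousOn_blockFn_time hce hMe j x)
  set S : ℝ → ℝ≥0∞ := fun t => ⨆ x, ‖blockFn j (we t) x‖ₑ with hS
  have hlsc : LowerSemicontinuous S :=
    lowerSemicontinuous_iSup fun x => ((hct x).enorm).lowerSemicontinuous
  refine ⟨S, hlsc.measurable, fun t ht => ?_⟩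
  -- on the slab the clamp is the identity and the block is continuous in `x`
  have hwt : we t = w t := by simp only [hwe, projIcc_of_mem hab ht]
  have hcx : Continuous (blockFn j (w t)) := by
    have h := continuousOn_blockFn_uncurry hc hM j
    have h1 : Continuous fun x : EuclideanSpace ℝ ι => (fun z : ℝ × EuclideanSpace ℝ ι => blockFn j (w z.1) z.2) (t, x) :=
      h.comp_continuous (continuous_const.prodMk continuous_id) fun x => ⟨ht, mem_univ _⟩
    exact h1
  simp only [hS, hwt]
  rw [blockSup, eLpNorm_top_eq_iSup_enorm_of_continuous hcx]

/-- **The occupation integrand is a.e.-measurable in time on a continuous bounded slab**: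
`τ ↦ 1_{2^q ≤ Λ_{c,ν}(w τ)} 2^q ‖Δ̇_q w(τ)‖_∞` is `AEMeasurable` for `volume.restrict (Icc a b)` — the set
`{2^q ≤ Λ}` is `{q = 0} ∪ ⋃_{j ≥ q} {c ν 2^j ≤ ‖Δ̇_j w‖_∞}` (tree `two_pow_le_dissipationWavenumber_iff`) and
the block sups are measurable modifications on the slab. [cite: CheskidovDai2015, §3.1 (the sum over levels under the time integral)] -/
theorem aemeasurable_occupation_restrict {ι : Type*} [Fintype ι] {a b : ℝ} (hab : a ≤ b)
    {w : ℝ → EuclideanSpace ℝ ι → EuclideanSpace ℝ ι}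
    (hc : ContinuousOn (uncurry w) (Icc a b ×ˢ univ)) {M : ℝ} (hM : ∀ t ∈ Icc a b, ∀ x, ‖w t x‖ ≤ M)
    (c ν : ℝ) (q : ℕ) :
    AEMeasurable (fun τ => {τ' : ℝ | (2 : ℝ≥0∞) ^ q ≤ dissipationWavenumber c ν (w τ')}.indicator
        (fun τ' => (2 : ℝ≥0∞) ^ q * eLpNorm (blockFn (q : ℤ) (w τ')) ∞ volume) τ)
      (volume.restrict (Icc a b)) := by
  choose S hSm hSeq using fun j : ℤ => exists_measurable_eq_blockSup hab hc hM j
  -- measurable versions of the set and of the integrand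
  set A : Set ℝ := {τ | q = 0 ∨ ∃ j : ℕ, q ≤ j ∧ ENNReal.ofReal (c * ν) * 2 ^ j ≤ S (j : ℤ) τ} with hA
  have hAm : MeasurableSet A := by
    have : A = {τ | q = 0} ∪ ⋃ j : ℕ, {τ | q ≤ j ∧ ENNReal.ofReal (c * ν) * 2 ^ j ≤ S (j : ℤ) τ} := by
      ext τ; simp [hA]
    rw [this]
    refine (MeasurableSet.const _).union (MeasurableSet.iUnion fun j => ?_)
    by_cases hqj : q ≤ j
    · simp only [hqj, true_and]
      exact measurableSet_le measurable_const (hSm j)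
    · simp only [hqj, false_and, setOf_false, MeasurableSet.empty]
  set G : ℝ → ℝ≥0∞ := A.indicator fun τ => (2 : ℝ≥0∞) ^ q * S (q : ℤ) τ with hG
  have hGm : Measurable G := (measurable_const.mul (hSm q)).indicator hAm
  refine ⟨G, hGm, ?_⟩
  refine (ae_restrict_mem measurableSet_Icc).mono fun τ hτ => ?_
  -- on the slab the two integrands coincide
  have hset : τ ∈ {τ' : ℝ | (2 : ℝ≥0∞) ^ q ≤ dissipationWavenumber c ν (w τ')} ↔ τ ∈ A := by
    simp only [mem_setOf_eq, hA, two_pow_le_dissipationWavenumber_iff, isSaturatedLevel_iff]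
    refine or_congr Iff.rfl (exists_congr fun j => and_congr Iff.rfl ?_)
    rw [hSeq (j : ℤ) τ hτ, blockSup]
  show {τ' : ℝ | (2 : ℝ≥0∞) ^ q ≤ dissipationWavenumber c ν (w τ')}.indicator
      (fun τ' => (2 : ℝ≥0∞) ^ q * eLpNorm (blockFn (q : ℤ) (w τ')) ∞ volume) τ = G τ
  by_cases hmem : τ ∈ A
  · rw [hG, indicator_of_mem hmem, indicator_of_mem (hset.2 hmem), hSeq (q : ℤ) τ hτ, blockSup]
  · rw [hG, indicator_of_notMem hmem, indicator_of_notMem (fun h => hmem (hset.1 h))]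

end Measurable

end Literature.Analysis.FluidPDE

end
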